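import Summits.CriticalPhenomena.PercolationContinuityZ3.Theorems.SahiMasterFamilyEqPrincipal
import Literature.Probability.LatticeModels.ProdBernoulliAtomExpansion

/-!
# The partition triple `(AND(S_i)·OR(S_iᶜ))_{i<3}`: `E_3 = ∏ p q · (Q_0 + Q_1 + Q_2 − Q_0Q_1Q_2) ≥ 0`, every ground set

Unit `prim-masterthm-p4` (gen 11; crux anchor stmt-CriticalPhenomena-4575, helper work; memo
`run/shared/lean/prim/prim-masterthm/prim-masterthm-p4/FACE-QUOTIENT-3.md` §3).  For a partition `S_0 ⊔ S_1 ⊔ S_2` of a finite ground set into three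
non-empty blocks, the triple of increasing events `U_i := {ω : S_i ⊆ ω and ω meets S_iᶜ}` ("all of my block, something outside it") is the
`G_I = 2` extremal family of the census of face-vanishing common-pivotal triples: it lies in the RESIDUAL class 𝓡₃ of the `k`-induction (antichain,
pairwise dependent, no cylinder member) with EVERY coordinate pivotal for all three members — outside every proved stratum of Kahn's Conjecture 5 /
Sahi's `C_3` in the tree (principal slot, nested pair, independent pair, thin-edge class T).  We compute Sahi's functional in closed form:

* `sahiE_three_partitionTriple` — with `P_i = ∏_{e∈S_i} p_e`, `Q_i = ∏_{e∈S_i} (1−p_e)`: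
  `E_3(μ_p; 1_{U_0},1_{U_1},1_{U_2}) = (∏_e p_e(1−p_e)) · (Q_0 + Q_1 + Q_2 − Q_0 Q_1 Q_2)`;
* `sahiE_three_partitionTriple_nonneg` — hence `E_3 ≥ 0` on the closed cube for this family, every ground set, every partition
  (an explicit new instance family of `C_3` for product measures); the face quotient is `R = Q_0+Q_1+Q_2−Q_0Q_1Q_2`, `R(0) = 2 = G_I`, `R(1) = 0`.
HONEST FRAMING: one explicit family; `C_3` / Kahn's Conjecture 5 remain OPEN. [this work]
-/

noncomputable section

open scoped Classical

namespace Summit.CriticalPhenomena.PercolationContinuityZ3.Theorems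

namespace PartitionTriple

open Finset Function
open Literature.Combinatorics.Sahi2008
open Literature.Probability.LatticeModels (prodBernoulli prodBernoulli_real_setOf_forall_iff)
open Literature.Probability.Percolation.DecisionTree (ind ind_of_mem ind_of_not_mem ind_nonneg)

variable {ι : Type} [Fintype ι]

/-- The cylinder `[A ⊆ ω]`. [folklore] -/
def cyl (A : Finset ι) : Set (Set ι) := {ω | (↑A : Set ι) ⊆ ω}

/-- The member `U_A := {ω : A ⊆ ω, ω ⊄ A}` = `AND(A) · OR(Aᶜ)`. [this work] -/
def andOr (A : Finset ι) : Set (Set ι) := {ω | (↑A : Set ι) ⊆ ω ∧ ∃ e, e ∉ A ∧ e ∈ ω}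

/-! ### Measures of cylinders and of `AND·OR` -/

/-- `μ_p([A ⊆ ω]) = ∏_{e∈A} p_e`. [folklore] -/
theorem ex_ind_cyl (p : ι → unitInterval) (A : Finset ι) :
    ex (bernoulliWeight p) (ind (cyl A)) = ∏ e ∈ A, (p e : ℝ) := by
  rw [ex_bernoulliWeight_ind]
  have hset : cyl A = {ω : Set ι | ∀ i ∈ A, (i ∈ ω ↔ True)} := by
    ext ω; simp only [cyl, Set.mem_setOf_eq, iff_true]; exact Iff.rfl
  rw [hset, prodBernoulli_real_setOf_forall_iff]
  exact prod_congr rfl fun i _ => by rw [if_pos trivial]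

/-- `μ_p({↑A}) = ∏_{e∈A} p_e · ∏_{e∉A} (1−p_e)` (the single configuration `A`). [folklore] -/
theorem ex_ind_singleton (p : ι → unitInterval) (A : Finset ι) :
    ex (bernoulliWeight p) (ind {(↑A : Set ι)}) = (∏ e ∈ A, (p e : ℝ)) * ∏ e ∈ univ \ A, (1 - (p e : ℝ)) := by
  rw [ex_bernoulliWeight_ind]
  have hset : ({(↑A : Set ι)} : Set (Set ι)) = {ω : Set ι | ∀ i ∈ (univ : Finset ι), (i ∈ ω ↔ i ∈ A)} := by
    ext ω
    simp only [Set.mem_singleton_iff, Set.mem_setOf_eq, mem_univ, true_implies]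
    constructor
    · rintro rfl i; exact Finset.mem_coe
    · intro h; ext i; rw [h i, Finset.mem_coe]
  rw [hset, prodBernoulli_real_setOf_forall_iff, ← prod_filter_mul_prod_filter_not univ (fun i => i ∈ A)]
  congr 1
  · rw [Finset.filter_mem_eq_inter, univ_inter]
    exact prod_congr rfl fun i hi => by rw [if_pos hi]
  · rw [show univ.filter (fun i => i ∉ A) = univ \ A by ext i; simp]
    exact prod_congr rfl fun i hi => by rw [if_neg (mem_sdiff.1 hi).2]

omit [Fintype ι] in
/-- `1_{[A ⊆ ω]} = 1_{U_A} + 1_{{A}}` (the cylinder is `U_A` plus the single configuration `A`). [this work] -/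
theorem ind_cyl_eq (A : Finset ι) : ind (cyl A) = ind (andOr A) + ind ({(↑A : Set ι)} : Set (Set ι)) := by
  funext ω
  simp only [Pi.add_apply]
  by_cases hA : (↑A : Set ι) ⊆ ω
  · by_cases hex : ∃ e, e ∉ A ∧ e ∈ ω
    · have hne : ω ≠ ↑A := by
        rintro rfl; obtain ⟨e, he, he'⟩ := hex; exact he (Finset.mem_coe.1 he')
      rw [ind_of_mem (show ω ∈ cyl A from hA), ind_of_mem (show ω ∈ andOr A from ⟨hA, hex⟩),
        ind_of_not_mem (show ω ∉ ({(↑A : Set ι)} : Set (Set ι)) from hne), add_zero]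
    · have heq : ω = ↑A := by
        refine Set.Subset.antisymm (fun e he => ?_) hA
        by_contra h; exact hex ⟨e, fun h' => h (Finset.mem_coe.2 h'), he⟩
      rw [ind_of_mem (show ω ∈ cyl A from hA), ind_of_not_mem (show ω ∉ andOr A from fun h => hex h.2),
        ind_of_mem (show ω ∈ ({(↑A : Set ι)} : Set (Set ι)) from heq), zero_add]
  · rw [ind_of_not_mem (show ω ∉ cyl A from hA), ind_of_not_mem (show ω ∉ andOr A from fun h => hA h.1),
      ind_of_not_mem (show ω ∉ ({(↑A : Set ι)} : Set (Set ι)) from fun h => hA (by rw [Set.mem_singleton_iff.1 h])), add_zero]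

/-- `μ_p(U_A) = ∏_{e∈A} p_e · (1 − ∏_{e∉A}(1−p_e))`. [this work] -/
theorem ex_ind_andOr (p : ι → unitInterval) (A : Finset ι) :
    ex (bernoulliWeight p) (ind (andOr A)) = (∏ e ∈ A, (p e : ℝ)) * (1 - ∏ e ∈ univ \ A, (1 - (p e : ℝ))) := by
  have h := ex_ind_cyl p A
  rw [ind_cyl_eq, ex_add, ex_ind_singleton] at h
  linarith

/-! ### The partition triple -/

variable (S : Fin 3 → Finset ι)

omit [Fintype ι] in
/-- Intersections of two members are cylinders: `U_{S_i} ∩ U_{S_j} = [S_i ∪ S_j ⊆ ω]` for disjoint non-empty blocks. [this work] -/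
theorem andOr_inter_andOr {A B : Finset ι} (hAB : Disjoint A B) (hA : A.Nonempty) (hB : B.Nonempty) :
    andOr A ∩ andOr B = cyl (A ∪ B) := by
  ext ω
  simp only [andOr, cyl, Set.mem_inter_iff, Set.mem_setOf_eq, Finset.coe_union, Set.union_subset_iff]
  constructor
  · rintro ⟨⟨hA', -⟩, ⟨hB', -⟩⟩; exact ⟨hA', hB'⟩
  · rintro ⟨hA', hB'⟩
    obtain ⟨a, ha⟩ := hA
    obtain ⟨b, hb⟩ := hB
    exact ⟨⟨hA', b, Finset.disjoint_right.1 hAB hb, hB' (Finset.mem_coe.2 hb)⟩,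
      ⟨hB', a, Finset.disjoint_left.1 hAB ha, hA' (Finset.mem_coe.2 ha)⟩⟩

/-- **Sahi's `E_3` of the partition triple in closed form.**  For three pairwise disjoint non-empty blocks `S_0, S_1, S_2` covering the ground set,
`E_3(μ_p; 1_{U_{S_0}}, 1_{U_{S_1}}, 1_{U_{S_2}}) = (∏_e p_e(1−p_e)) · (Q_0 + Q_1 + Q_2 − Q_0Q_1Q_2)` with `Q_i = ∏_{e∈S_i}(1 − p_e)`. [this work] -/
theorem sahiE_three_partitionTriple (p : ι → unitInterval) (h01 : Disjoint (S 0) (S 1)) (h02 : Disjoint (S 0) (S 2)) (h12 : Disjoint (S 1) (S 2))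
    (hne : ∀ i, (S i).Nonempty) (hcov : S 0 ∪ S 1 ∪ S 2 = univ) :
    sahiE (bernoulliWeight p) 3 (fun i => ind (andOr (S i))) =
      (∏ e, (p e : ℝ) * (1 - p e)) *
        ((∏ e ∈ S 0, (1 - (p e : ℝ))) + (∏ e ∈ S 1, (1 - (p e : ℝ))) + (∏ e ∈ S 2, (1 - (p e : ℝ))) -
          (∏ e ∈ S 0, (1 - (p e : ℝ))) * (∏ e ∈ S 1, (1 - (p e : ℝ))) * ∏ e ∈ S 2, (1 - (p e : ℝ))) := by
  -- abbreviations
  set P0 := ∏ e ∈ S 0, (p e : ℝ) with hP0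
  set P1 := ∏ e ∈ S 1, (p e : ℝ) with hP1
  set P2 := ∏ e ∈ S 2, (p e : ℝ) with hP2
  set Q0 := ∏ e ∈ S 0, (1 - (p e : ℝ)) with hQ0
  set Q1 := ∏ e ∈ S 1, (1 - (p e : ℝ)) with hQ1
  set Q2 := ∏ e ∈ S 2, (1 - (p e : ℝ)) with hQ2
  -- complements of blocks
  have hc0 : univ \ S 0 = S 1 ∪ S 2 := by
    ext e; simp only [mem_sdiff, mem_univ, true_and, mem_union]
    have := Finset.ext_iff.1 hcov e; simp only [mem_union, mem_univ, iff_true] at this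
    constructor
    · intro h0; rcases this with (h | h) | h
      · exact absurd h h0
      · exact Or.inl h
      · exact Or.inr h
    · rintro (h | h) h0
      · exact Finset.disjoint_left.1 h01 h0 h
      · exact Finset.disjoint_left.1 h02 h0 h
  have hc1 : univ \ S 1 = S 0 ∪ S 2 := by
    ext e; simp only [mem_sdiff, mem_univ, true_and, mem_union]
    have := Finset.ext_iff.1 hcov e; simp only [mem_union, mem_univ, iff_true] at this
    constructor
    · intro h1; rcases this with (h | h) | h
      · exact Or.inl h
      · exact absurd h h1
      · exact Or.inr h
    · rintro (h | h) h1
      · exact Finset.disjoint_left.1 h01 h h1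
      · exact Finset.disjoint_left.1 h12 h1 h
  have hc2 : univ \ S 2 = S 0 ∪ S 1 := by
    ext e; simp only [mem_sdiff, mem_univ, true_and, mem_union]
    have := Finset.ext_iff.1 hcov e; simp only [mem_union, mem_univ, iff_true] at this
    constructor
    · intro h2; rcases this with (h | h) | h
      · exact Or.inl h
      · exact Or.inr h
      · exact absurd h h2
    · rintro (h | h) h2
      · exact Finset.disjoint_left.1 h02 h h2
      · exact Finset.disjoint_left.1 h12 h h2
  have h01' := h01
  have hu02 : Disjoint (S 0 ∪ S 1) (S 2) := disjoint_union_left.2 ⟨h02, h12⟩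
  -- the seven moments
  have m0 : ex (bernoulliWeight p) (ind (andOr (S 0))) = P0 * (1 - Q1 * Q2) := by
    rw [ex_ind_andOr, hc0, prod_union h12]
  have m1 : ex (bernoulliWeight p) (ind (andOr (S 1))) = P1 * (1 - Q0 * Q2) := by
    rw [ex_ind_andOr, hc1, prod_union h02]
  have m2 : ex (bernoulliWeight p) (ind (andOr (S 2))) = P2 * (1 - Q0 * Q1) := by
    rw [ex_ind_andOr, hc2, prod_union h01]
  have m01 : ex (bernoulliWeight p) (ind (andOr (S 0)) * ind (andOr (S 1))) = P0 * P1 := by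
    rw [ind_mul_ind_eq_inter, andOr_inter_andOr h01 (hne 0) (hne 1), ex_ind_cyl, prod_union h01]
  have m02 : ex (bernoulliWeight p) (ind (andOr (S 0)) * ind (andOr (S 2))) = P0 * P2 := by
    rw [ind_mul_ind_eq_inter, andOr_inter_andOr h02 (hne 0) (hne 2), ex_ind_cyl, prod_union h02]
  have m12 : ex (bernoulliWeight p) (ind (andOr (S 1)) * ind (andOr (S 2))) = P1 * P2 := by
    rw [ind_mul_ind_eq_inter, andOr_inter_andOr h12 (hne 1) (hne 2), ex_ind_cyl, prod_union h12]
  have m012 : ex (bernoulliWeight p) (ind (andOr (S 0)) * ind (andOr (S 1)) * ind (andOr (S 2))) = P0 * P1 * P2 := by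
    rw [ind_mul_ind_eq_inter, andOr_inter_andOr h01 (hne 0) (hne 1), ind_mul_ind_eq_inter]
    have : cyl (S 0 ∪ S 1) ∩ andOr (S 2) = cyl (S 0 ∪ S 1 ∪ S 2) := by
      ext ω
      simp only [cyl, andOr, Set.mem_inter_iff, Set.mem_setOf_eq, Finset.coe_union, Set.union_subset_iff]
      constructor
      · rintro ⟨⟨h0, h1⟩, h2, -⟩; exact ⟨⟨h0, h1⟩, h2⟩
      · rintro ⟨⟨h0, h1⟩, h2⟩
        obtain ⟨a, ha⟩ := hne 0
        exact ⟨⟨h0, h1⟩, h2, a, Finset.disjoint_left.1 h02 ha, h0 (Finset.mem_coe.2 ha)⟩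
    rw [this, ex_ind_cyl, prod_union hu02, prod_union h01]
  -- the whole-cube products
  have hpp : ∏ e, (p e : ℝ) * (1 - p e) = (P0 * P1 * P2) * (Q0 * Q1 * Q2) := by
    rw [prod_mul_distrib, ← hcov, prod_union hu02, prod_union h01, prod_union hu02, prod_union h01]
  -- Sahi's formula
  rw [sahiE_three_apply]
  rw [m012, m0, m1, m2, m12, m02, m01, hpp]
  ring

/-- **`C_3` on the partition family**: `E_3 ≥ 0` for the triple `(AND(S_i)·OR(S_iᶜ))_i` under every product measure on every finite ground set
(strict in the open cube, since `Q_0 + Q_1 + Q_2 − Q_0Q_1Q_2 ≥ Q_1 + Q_2 > 0` there). [this work] -/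
theorem sahiE_three_partitionTriple_nonneg (p : ι → unitInterval) (h01 : Disjoint (S 0) (S 1)) (h02 : Disjoint (S 0) (S 2))
    (h12 : Disjoint (S 1) (S 2)) (hne : ∀ i, (S i).Nonempty) (hcov : S 0 ∪ S 1 ∪ S 2 = univ) :
    0 ≤ sahiE (bernoulliWeight p) 3 (fun i => ind (andOr (S i))) := by
  rw [sahiE_three_partitionTriple S p h01 h02 h12 hne hcov]
  have hq : ∀ A : Finset ι, 0 ≤ ∏ e ∈ A, (1 - (p e : ℝ)) ∧ ∏ e ∈ A, (1 - (p e : ℝ)) ≤ 1 := fun A =>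
    ⟨prod_nonneg fun e _ => sub_nonneg.2 (p e).2.2,
     prod_le_one (fun e _ => sub_nonneg.2 (p e).2.2) fun e _ => sub_le_self _ (p e).2.1⟩
  refine mul_nonneg (prod_nonneg fun e _ => mul_nonneg (p e).2.1 (sub_nonneg.2 (p e).2.2)) ?_
  obtain ⟨h0a, h0b⟩ := hq (S 0)
  obtain ⟨h1a, h1b⟩ := hq (S 1)
  obtain ⟨h2a, h2b⟩ := hq (S 2)
  have : (∏ e ∈ S 0, (1 - (p e : ℝ))) * (∏ e ∈ S 1, (1 - (p e : ℝ))) * (∏ e ∈ S 2, (1 - (p e : ℝ))) ≤ ∏ e ∈ S 0, (1 - (p e : ℝ)) := by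
    calc (∏ e ∈ S 0, (1 - (p e : ℝ))) * (∏ e ∈ S 1, (1 - (p e : ℝ))) * (∏ e ∈ S 2, (1 - (p e : ℝ)))
        ≤ (∏ e ∈ S 0, (1 - (p e : ℝ))) * 1 * 1 := by gcongr
      _ = ∏ e ∈ S 0, (1 - (p e : ℝ)) := by ring
  linarith

end PartitionTriple

end Summit.CriticalPhenomena.PercolationContinuityZ3.Theorems
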